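import Mathlib
import Summits.NavierStokesRegularity.NavierStokesRegularity.Theorems.SubOnsagerCeilingSideBranchShellRetention
import HarnessLib

/-!
# Route SubOnsagerCeiling — the PER-SHELL RETENTION target of `α_SB`, named
# (helper file for item stmt-NavierStokesRegularity-25507 `OrthantTailCeiling`; `--supports`)

Names the construction target to which the escape debt of the negative lemmas p824789 / p824871
(`SideBranchCeilingEscapeAt ε₀`) is reduced by `sideBranchCeilingEscapeAt_of_shellRetention`
(sibling file `…SideBranchShellRetention.lean`, hypothesis inline there):
`SideBranchShellRetentionAt ε₀ g η₀` — at a viscosity-uniform time every shell `1 ≤ j ≤ K` of the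
side-branch dead-end table holds at most the fraction `g` of the energy that escaped past the bond `j−1`,
and the datum shell at most `η₀E₀` — and records
`sideBranchCeilingEscapeAt_of_shellRetentionAt : g ≤ 1 − 1/(1+ε₀) → η₀ < 1 →
SideBranchShellRetentionAt ε₀ g η₀ → SideBranchCeilingEscapeAt ε₀`.
Numerically (this seat, MODEL instrument) the fractions are `≤ 0.21` at `b = 2` (allowed `1/2`) and
`≤ 0.18` at `b = 3/2` (allowed `1/3`).  NOTHING is asserted; a `Prop` and a reduction.

HONEST FRAMING: MODEL lattice ODEs only (Tao 2016 §4 vocabulary; rung TL-M2Break); settles nothing by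
itself; nothing here is a statement about the Navier–Stokes equations.
[cite: Tao2016AveragedNS, §4 (4.5), the viscous equation before Thm. 4.2]
-/

noncomputable section

-- the sub-problem namespace `NavierStokesRegularity.NavierStokesRegularity` is the tree's layout (D-0017)
set_option linter.dupNamespace false

namespace Summit.NavierStokesRegularity.NavierStokesRegularity.Theorems.SubOnsagerCeiling

open Set
open Literature.Analysis.FluidPDE.TaoCascade
open Summit.NavierStokesRegularity.NavierStokesRegularity.Theses.SubOnsagerCeiling

/-- **`SideBranchShellRetentionAt ε₀ g η₀` — PER-SHELL RETENTION for the side-branch table at scale ratio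
`b = 1+ε₀`** (`Prop`; NOTHING asserted; the construction target to which the escape debt is reduced).  For
every candidate ceiling `(θ, C)` there is a one-shell datum `X₀` of positive energy `E₀` such that for every
depth `K` there are a horizon `T > 0` and a viscosity threshold `ν₀ > 0` with: for every `0 < ν ≤ ν₀`, EVERY
regular solution of the `ν`-viscous `α_SB` lattice on `[0, T]` from `X₀` (one-shell datum, no shells below
`0`, Tao's weight bound (4.5), continuous modes, exact viscous equation within `[0,T]`) that is non-negative
on the shells `≥ 1` and obeys the `(θ, C)` tail ceiling on `[0,T]` satisfies, AT TIME `T`: the datum shell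
holds `≤ η₀·E₀`, and every shell `1 ≤ j ≤ K` holds `Σ_i ½X_{i,j}(T)² ≤ g·(E₀ − Σ_{m<j} Σ_i ½X_{i,m}(T)²)`
(at most the fraction `g` of what escaped past the bond `j−1`).  A CONSTRUCTION TARGET, not a published
fact. [cite: Tao2016AveragedNS, §4 (4.5), the viscous equation before Thm. 4.2] -/
@[conjecture] def SideBranchShellRetentionAt (ε₀ g η₀ : ℝ) : Prop :=
  ∀ θ : ℝ, 1 / 2 < θ → ∀ C : ℝ, 0 ≤ C →
    ∃ X₀ : Fin 4 → ℝ, 0 < (∑ i : Fin 4, (1 / 2 : ℝ) * X₀ i ^ 2) ∧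
    ∀ K : ℕ, ∃ T : ℝ, 0 < T ∧ ∃ ν₀ : ℝ, 0 < ν₀ ∧
      ∀ ν : ℝ, 0 < ν → ν ≤ ν₀ →
      ∀ X : Fin 4 → ℤ → ℝ → ℝ,
        (∀ (i : Fin 4) (k : ℤ), X i k 0 = if k = 0 then X₀ i else 0) →
        (∀ (i : Fin 4) (k : ℤ), k < 0 → ∀ t : ℝ, X i k t = 0) →
        (∃ M : ℝ, ∀ (t : ℝ) (i : Fin 4) (k : ℤ), (1 + (1 + ε₀) ^ ((10 : ℝ) * k)) * |X i k t| ≤ M) →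
        (∀ (i : Fin 4) (k : ℤ), Continuous (X i k)) →
        (∀ (i : Fin 4) (k : ℤ), ∀ t ∈ Set.Icc (0 : ℝ) T, HasDerivWithinAt (X i k)
          (quadTerm ε₀ sideBranchTable X i k t - ν * (1 + ε₀) ^ ((2 : ℝ) * k) * X i k t)
          (Set.Icc (0 : ℝ) T) t) →
        (∀ t ∈ Set.Icc (0 : ℝ) T, ∀ (i : Fin 4) (k : ℤ), 1 ≤ k → 0 ≤ X i k t) →
        (∀ n N : ℕ, n ≤ N → ∀ u ∈ Set.Icc (0 : ℝ) T,
          ∑ k ∈ Finset.Icc n N, ∑ i : Fin 4, (1 / 2 : ℝ) * X i (k : ℤ) u ^ 2 ≤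
            C * (∑ i : Fin 4, (1 / 2 : ℝ) * X₀ i ^ 2) * (1 + ε₀) ^ (-(2 * θ * (n : ℝ)))) →
        (∑ i : Fin 4, (1 / 2 : ℝ) * X i 0 T ^ 2) ≤ η₀ * (∑ i : Fin 4, (1 / 2 : ℝ) * X₀ i ^ 2) ∧
        (∀ j : ℕ, 1 ≤ j → j ≤ K →
          (∑ i : Fin 4, (1 / 2 : ℝ) * X i (j : ℤ) T ^ 2) ≤
            g * ((∑ i : Fin 4, (1 / 2 : ℝ) * X₀ i ^ 2) -
              ∑ m ∈ Finset.range j, ∑ i : Fin 4, (1 / 2 : ℝ) * X i (m : ℤ) T ^ 2))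


/-- **Named form of the reduction**: `SideBranchShellRetentionAt ε₀ g η₀ → SideBranchCeilingEscapeAt ε₀` for
`g ≤ 1 − 1/(1+ε₀)`, `η₀ < 1` (`sideBranchCeilingEscapeAt_of_shellRetention`). MODEL lattice only; a
reduction between unproved statements. [this file] -/
theorem sideBranchCeilingEscapeAt_of_shellRetentionAt {ε₀ g η₀ : ℝ} (hε : 0 < ε₀)
    (hg : g ≤ 1 - 1 / (1 + ε₀)) (hη : η₀ < 1) (h : SideBranchShellRetentionAt ε₀ g η₀) :
    SideBranchCeilingEscapeAt ε₀ :=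
  sideBranchCeilingEscapeAt_of_shellRetention hε hg hη h

end Summit.NavierStokesRegularity.NavierStokesRegularity.Theorems.SubOnsagerCeiling

end
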